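import Summits.AtomisticToContinuum.BoseEinsteinCondensation.Theorems.DensityResponse.Negative.Tightness
import Summits.AtomisticToContinuum.BoseEinsteinCondensation.Theorems.BECThomsonPrincipleDensityResponseKineticSignCoherence

/-!
# Negative lemmas for crux `DensityResponse` (stmt-AtomisticToContinuum-9481) — stub S2 `stub_constitutiveCore`
# of line `force-balance-constitutive`: the truncation threshold is load-bearing (the core is FALSE for the free truncation)

Supports (does not close) stmt-AtomisticToContinuum-9481.  Refuter (drefute, generation 3) by-product over the lead's
`Defs` (`CoreIneq`, `stressWave`, `effNumber`, …) and the landed Negative lemmas (`prodStateη`, …).  Sorry-free; no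
`Theses` declaration asserted, no new `Prop` declared.
* `sourceMean/effNumber/kineticStressWave/stressWave_…_prodStateη`, `virialWave_zero_potential`: the four waves of the
  `η`-modulated FREE product state `∏ᵢ c_η(1 + 2η cos θᵢ)` in the mode `e₀`: `m = 4ηN/(1+2η²)`, `N_eff = (1+η²)N/(1+2η²)`,
  `K_k = 0` (`∫cos θ sin²θ = 0`), `I_k = 0`, `P_k = (|k|²/4)m`; stationary at `s = |k|²η/(1+η²)`, sub-ground iff `η ≤ 1`.
* **`coreIneq_zero_potential_false`**: `a > 0`, `M, ρ₀, κ > 0` ⟹ `¬ CoreIneq 0 a M ρ₀ κ C₁ N₀` (η = 1, `s = |k|²/2`, `L = N/β`,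
  `N ≥ β³/ρ₀`: the conclusion reads `2κaβ ≤ 3π²C₁`).  The free response `m/(sN) = 8/(3|k|²)` carries no stiffness `ρa`
  (infinite compressibility in the IR corner) while `K_k ≡ 0`: in any proof of S2 the stiffness must come out of `I_k`.
  `coreIneq_zero_zero`: at `a = 0` it HOLDS (window pins `s = 0`, sub-ground pins `T = 0`).
* **`constitutiveCore_false_without_threshold`**, `not_coreIneq_trunc_zero`: S2 with `∃ t₀ ∀ t ≥ t₀ ↦ ∀ t` is FALSE
  (`truncPotential v 0 = 0`, square well `8·𝟙_{r≤1}` with `a ≥ 1/2`); unlike S3b (closed with `t₀ = 0`, blind to the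
  potential) S2 must use the interaction of `v_t`.  Complement: Disproof gen 3 §16 `coreIneq_trunc_of_densityResponse`
  (crux ⟹ `CoreIneq (v_t) a(v) …` for every `t` with `a(v_t) ≠ 0`, i.e. `t ≥ 1`) — that guard is necessary.
-/

namespace Summit.AtomisticToContinuum.BoseEinsteinCondensation.Theorems.DensityResponse.Negative.ForceBalanceStubs

open MeasureTheory
open scoped ENNReal
open Literature.MathematicalPhysics.QuantumManyBody.BoseGas
open Summit.AtomisticToContinuum.BoseEinsteinCondensation.Theses
open Summit.AtomisticToContinuum.BoseEinsteinCondensation.Cruxes.DensityResponse.ForceBalanceConstitutive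
open Summit.AtomisticToContinuum.BoseEinsteinCondensation.Theorems.DensityResponse.Negative

noncomputable section

variable {N : ℕ} {L : ℝ}

/-! ## The mode `e₀ = (1,0,0)` -/

/-- The phase of the mode `e₀` is `θ = 2πx₀/L`. [folklore] -/
theorem phase_e0 (L : ℝ) (X : Config N) (i : Fin N) :
    _root_.Summit.AtomisticToContinuum.BoseEinsteinCondensation.Cruxes.DensityResponse.ForceBalanceConstitutive.phase
      L (Pi.single 0 1) X i = θL L (X i) := by
  unfold _root_.Summit.AtomisticToContinuum.BoseEinsteinCondensation.Cruxes.DensityResponse.ForceBalanceConstitutive.phase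
    θL
  simp [Pi.single_apply]

/-- The crux's phase expression of the mode `e₀` is `θ = 2πx₀/L`. [folklore] -/
theorem cruxPhase_e0 (L : ℝ) (x : Space) :
    2 * Real.pi / L * ∑ j, ((Pi.single 0 1 : Fin 3 → ℤ) j : ℝ) * x j = θL L x := by
  simp [Pi.single_apply, θL]

/-- `|k|² = (2π/L)²` for the mode `e₀`. [folklore] -/
theorem ksq_e0 (L : ℝ) : ksq L (Pi.single 0 1) = (2 * Real.pi / L) ^ 2 := by
  unfold ksq
  simp [Pi.single_apply]

/-- `e₀ ≠ 0`. [folklore] -/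
theorem e0_ne_zero : (Pi.single 0 1 : Fin 3 → ℤ) ≠ 0 := by
  intro h0; have := congr_fun h0 0; simp at this

/-- `‖e₀‖∞ = 1`. [folklore] -/
theorem norm_e0 : ‖(fun j => ((Pi.single 0 1 : Fin 3 → ℤ) j : ℝ))‖ = 1 := by
  have : (fun j => ((Pi.single 0 1 : Fin 3 → ℤ) j : ℝ)) = Pi.single (0 : Fin 3) (1 : ℝ) := by
    funext j; simp only [Pi.single_apply]; split_ifs <;> simp
  rw [this, Pi.norm_single, norm_one]

/-- `k·∇ᵢ g = (2π/L) ∂_{i,0} g` for the mode `e₀`. [folklore] -/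
theorem kDeriv_e0 (L : ℝ) (g : Config N → ℂ) (X : Config N) (i : Fin N) :
    kDeriv L (Pi.single 0 1) g X i = (2 * Real.pi / L) • fderiv ℝ g X (unitVec i 0) := by
  rw [kDeriv_eq_sum, Fin.sum_univ_three]
  simp [unitVec]

/-! ## The four waves of the `η`-modulated free product state in the mode `e₀` -/

/-- **Density wave** `m(Φ_η) = 4ηN/(1+2η²)`. [folklore] -/
theorem sourceMean_e0_prodStateη (η : ℝ) (N : ℕ) (hL : 0 < L) :
    sourceMean (Pi.single 0 1) (prodStateη η N hL) = N * (4 * η / (1 + 2 * η ^ 2)) := by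
  unfold sourceMean
  simp_rw [cruxPhase_e0]
  exact source_prodStateη η N hL

/-- `2 sin²θ (1 + 2η cos θ)²` in cosines of multiples. [folklore] -/
theorem two_sin_sq_mul_profη_sq_eq (η L : ℝ) (x : Space) :
    2 * Real.sin (θL L x) ^ 2 * profη η L x ^ 2 =
      (1 + η ^ 2) + 2 * η * Real.cos ((1 : ℤ) * θL L x) - Real.cos ((2 : ℤ) * θL L x)
        - 2 * η * Real.cos ((3 : ℤ) * θL L x) - η ^ 2 * Real.cos ((4 : ℤ) * θL L x) := by
  unfold profη
  push_cast
  have h4 : Real.cos (4 * θL L x) = 2 * (2 * Real.cos (θL L x) ^ 2 - 1) ^ 2 - 1 := by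
    rw [show (4 : ℝ) * θL L x = 2 * (2 * θL L x) by ring, Real.cos_two_mul, Real.cos_two_mul]
  rw [one_mul, Real.cos_two_mul, Real.cos_three_mul, h4, Real.sin_sq]
  ring

/-- `2 cos θ sin²θ` in cosines of multiples. [folklore] -/
theorem two_cos_mul_sin_sq_eq (L : ℝ) (x : Space) :
    2 * Real.cos (θL L x) * Real.sin (θL L x) ^ 2 =
      1 / 2 * Real.cos ((1 : ℤ) * θL L x) - 1 / 2 * Real.cos ((3 : ℤ) * θL L x) := by
  push_cast
  rw [one_mul, Real.cos_three_mul, Real.sin_sq]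
  ring

/-- `∫_cell 2 sin²θ (1 + 2η cos θ)² = (1 + η²) L³`. [folklore] -/
theorem integral_cell_two_sin_sq_profη_sq (η : ℝ) (hL : 0 < L) :
    ∫ x in cell L, 2 * Real.sin (θL L x) ^ 2 * profη η L x ^ 2 = (1 + η ^ 2) * L ^ 3 := by
  simp_rw [two_sin_sq_mul_profη_sq_eq]
  have hc : IntegrableOn (fun _ : Space => (1 + η ^ 2 : ℝ)) (cell L) := integrableOn_const (volume_cell_ne_top L)
  have h1 := (integrableOn_cell_cos L 1).const_mul (2 * η)
  have h2 := integrableOn_cell_cos L 2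
  have h3 := (integrableOn_cell_cos L 3).const_mul (2 * η)
  have h4 := (integrableOn_cell_cos L 4).const_mul (η ^ 2)
  rw [integral_sub (((hc.fun_add h1).fun_sub h2).fun_sub h3) h4,
    integral_sub ((hc.fun_add h1).fun_sub h2) h3, integral_sub (hc.fun_add h1) h2, integral_add hc h1,
    setIntegral_const, integral_const_mul, integral_const_mul, integral_const_mul,
    integral_cell_cos hL one_ne_zero, integral_cell_cos hL two_ne_zero, integral_cell_cos hL (by norm_num),
    integral_cell_cos hL (by norm_num), volume_real_cell hL.le, smul_eq_mul]
  ring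

/-- `∫_cell 2 cos θ sin²θ = 0`. [folklore] -/
theorem integral_cell_two_cos_sin_sq (hL : 0 < L) :
    ∫ x in cell L, 2 * Real.cos (θL L x) * Real.sin (θL L x) ^ 2 = 0 := by
  simp_rw [two_cos_mul_sin_sq_eq]
  have h1 := (integrableOn_cell_cos L 1).const_mul (1 / 2)
  have h3 := (integrableOn_cell_cos L 3).const_mul (1 / 2)
  rw [integral_sub h1 h3, integral_const_mul, integral_const_mul,
    integral_cell_cos hL one_ne_zero, integral_cell_cos hL (by norm_num)]
  ring

/-- **Effective number** `N_eff(Φ_η) = (1+η²)N/(1+2η²)`. [folklore] -/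
theorem effNumber_e0_prodStateη (η : ℝ) (N : ℕ) (hL : 0 < L) :
    effNumber (Pi.single 0 1) (prodStateη η N hL) = N * ((1 + η ^ 2) / (1 + 2 * η ^ 2)) := by
  unfold effNumber
  simp_rw [phase_e0]
  rw [prodStateη_ψ]
  have hpt : ∀ X : Config N, (∑ i, 2 * Real.sin (θL L (X i)) ^ 2) * ‖prodFunη η N L X‖ ^ 2 =
      ∑ i, (2 * Real.sin (θL L (X i)) ^ 2 * ‖orbη η L (X i)‖ ^ 2) *
        ∏ j ∈ Finset.univ.erase i, ‖orbη η L (X j)‖ ^ 2 := by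
    intro X
    rw [norm_prodFunη_sq, Finset.sum_mul]
    refine Finset.sum_congr rfl fun i _ => ?_
    rw [← Finset.mul_prod_erase _ _ (Finset.mem_univ i)]
    ring
  simp_rw [hpt]
  have hgc : Continuous fun x => 2 * Real.sin (θL L x) ^ 2 * ‖orbη η L x‖ ^ 2 :=
    (continuous_const.mul ((Real.continuous_sin.comp (continuous_θL L)).pow 2)).mul
      ((continuous_orbη η L).norm.pow 2)
  have hgM : ∀ x, ‖2 * Real.sin (θL L x) ^ 2 * ‖orbη η L x‖ ^ 2‖ ≤ 2 * (cη η L * (1 + 2 * |η|)) ^ 2 := by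
    intro x
    rw [Real.norm_eq_abs, abs_mul, abs_mul, abs_of_nonneg (sq_nonneg ‖orbη η L x‖), abs_two,
      abs_of_nonneg (sq_nonneg _)]
    have h1 : Real.sin (θL L x) ^ 2 ≤ 1 := by
      rw [sq_le_one_iff_abs_le_one]; exact Real.abs_sin_le_one _
    have h2 : ‖orbη η L x‖ ^ 2 ≤ (cη η L * (1 + 2 * |η|)) ^ 2 :=
      pow_le_pow_left₀ (norm_nonneg _) (norm_orbη_le η hL x) 2
    calc 2 * Real.sin (θL L x) ^ 2 * ‖orbη η L x‖ ^ 2 ≤ 2 * 1 * (cη η L * (1 + 2 * |η|)) ^ 2 := by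
          gcongr
      _ = _ := by ring
  rw [integral_finsetSum _ fun i _ => ?_]
  · have hcell : ∫ x in cell L, 2 * Real.sin (θL L x) ^ 2 * ‖orbη η L x‖ ^ 2 =
        (1 + η ^ 2) / (1 + 2 * η ^ 2) := by
      simp_rw [norm_orbη_sq]
      have : ∀ x, 2 * Real.sin (θL L x) ^ 2 * (cη η L ^ 2 * profη η L x ^ 2) =
          cη η L ^ 2 * (2 * Real.sin (θL L x) ^ 2 * profη η L x ^ 2) := fun x => by ring
      simp_rw [this]
      rw [integral_const_mul, integral_cell_two_sin_sq_profη_sq η hL, cη_sq η hL]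
      have hp : (0 : ℝ) < 1 + 2 * η ^ 2 := by positivity
      field_simp
    simp_rw [integral_cellN_marked η N hL hgc hgM, hcell]
    simp
  · refine integrableOn_cellN_of_continuous (f := fun X : Config N =>
      (2 * Real.sin (θL L (X i)) ^ 2 * ‖orbη η L (X i)‖ ^ 2) *
        ∏ j ∈ Finset.univ.erase i, ‖orbη η L (X j)‖ ^ 2) ?_ L
    exact (hgc.comp (continuous_apply i)).mul
      (continuous_finsetProd _ fun j _ => ((continuous_orbη η L).norm.pow 2).comp (continuous_apply j))

/-- The longitudinal derivative of the product state, squared: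
`|k·∇ᵢΦ_η|² = (2π/L)² · c_η² 4η² (2π/L)² sin²θᵢ · ∏_{j≠i}|φ(xⱼ)|²`. [folklore] -/
theorem norm_kDeriv_prodFunη_sq (η : ℝ) (N : ℕ) (L : ℝ) (X : Config N) (i : Fin N) :
    ‖kDeriv L (Pi.single 0 1) (prodFunη η N L) X i‖ ^ 2 =
      (2 * Real.pi / L) ^ 2 * ((cη η L ^ 2 * (4 * η ^ 2 * (2 * Real.pi / L) ^ 2) * Real.sin (θL L (X i)) ^ 2) *
        ∏ j ∈ Finset.univ.erase i, ‖orbη η L (X j)‖ ^ 2) := by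
  rw [kDeriv_e0, norm_smul, mul_pow, Real.norm_eq_abs, sq_abs]
  congr 1
  rw [fderiv_prodFunη_unitVec, norm_mul, mul_pow, norm_prod, Finset.prod_pow,
    norm_fderiv_orbη_single_zero_sq, mul_comm]

/-- **Kinetic stress wave** `K_k(Φ_η) = 0` (the longitudinal kinetic density `∝ sin²θ` is symmetric
about the crests and troughs: `∫ cos θ sin²θ = 0`). [folklore] -/
theorem kineticStressWave_e0_prodStateη (η : ℝ) (N : ℕ) (hL : 0 < L) :
    kineticStressWave (Pi.single 0 1) (prodStateη η N hL) = 0 := by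
  unfold kineticStressWave
  simp_rw [phase_e0]
  rw [prodStateη_ψ]
  have hk : (2 * Real.pi / L) ^ 2 ≠ 0 := by positivity
  have hpt : ∀ X : Config N, ∑ i, 2 * Real.cos (θL L (X i)) *
      (‖kDeriv L (Pi.single 0 1) (prodFunη η N L) X i‖ ^ 2 / ksq L (Pi.single 0 1)) =
      ∑ i, (2 * Real.cos (θL L (X i)) *
        (cη η L ^ 2 * (4 * η ^ 2 * (2 * Real.pi / L) ^ 2) * Real.sin (θL L (X i)) ^ 2)) *
        ∏ j ∈ Finset.univ.erase i, ‖orbη η L (X j)‖ ^ 2 := by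
    intro X
    refine Finset.sum_congr rfl fun i _ => ?_
    rw [norm_kDeriv_prodFunη_sq, ksq_e0, mul_div_cancel_left₀ _ hk]
    ring
  simp_rw [hpt]
  have hgc : Continuous fun x => 2 * Real.cos (θL L x) *
      (cη η L ^ 2 * (4 * η ^ 2 * (2 * Real.pi / L) ^ 2) * Real.sin (θL L x) ^ 2) :=
    (continuous_const.mul (Real.continuous_cos.comp (continuous_θL L))).mul
      (continuous_const.mul ((Real.continuous_sin.comp (continuous_θL L)).pow 2))
  have hgM : ∀ x, ‖2 * Real.cos (θL L x) *
      (cη η L ^ 2 * (4 * η ^ 2 * (2 * Real.pi / L) ^ 2) * Real.sin (θL L x) ^ 2)‖ ≤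
      2 * (cη η L ^ 2 * (4 * η ^ 2 * (2 * Real.pi / L) ^ 2)) := by
    intro x
    rw [Real.norm_eq_abs, abs_mul, abs_mul, abs_mul, abs_two, abs_of_nonneg (sq_nonneg (Real.sin _)),
      abs_of_nonneg (by positivity : (0 : ℝ) ≤ cη η L ^ 2 * (4 * η ^ 2 * (2 * Real.pi / L) ^ 2))]
    have h1 : |Real.cos (θL L x)| ≤ 1 := Real.abs_cos_le_one _
    have h2 : Real.sin (θL L x) ^ 2 ≤ 1 := by
      rw [sq_le_one_iff_abs_le_one]; exact Real.abs_sin_le_one _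
    have h0 : (0 : ℝ) ≤ cη η L ^ 2 * (4 * η ^ 2 * (2 * Real.pi / L) ^ 2) := by positivity
    calc 2 * |Real.cos (θL L x)| * (cη η L ^ 2 * (4 * η ^ 2 * (2 * Real.pi / L) ^ 2) * Real.sin (θL L x) ^ 2)
        ≤ 2 * 1 * (cη η L ^ 2 * (4 * η ^ 2 * (2 * Real.pi / L) ^ 2) * 1) := by gcongr
      _ = _ := by ring
  rw [integral_finsetSum _ fun i _ => ?_]
  · have hcell : ∫ x in cell L, 2 * Real.cos (θL L x) *
        (cη η L ^ 2 * (4 * η ^ 2 * (2 * Real.pi / L) ^ 2) * Real.sin (θL L x) ^ 2) = 0 := by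
      have : ∀ x, 2 * Real.cos (θL L x) *
          (cη η L ^ 2 * (4 * η ^ 2 * (2 * Real.pi / L) ^ 2) * Real.sin (θL L x) ^ 2) =
          (cη η L ^ 2 * (4 * η ^ 2 * (2 * Real.pi / L) ^ 2)) * (2 * Real.cos (θL L x) * Real.sin (θL L x) ^ 2) :=
        fun x => by ring
      simp_rw [this]
      rw [integral_const_mul, integral_cell_two_cos_sin_sq hL, mul_zero]
    simp_rw [integral_cellN_marked η N hL hgc hgM, hcell]
    simp
  · refine integrableOn_cellN_of_continuous (f := fun X : Config N =>
      (2 * Real.cos (θL L (X i)) *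
        (cη η L ^ 2 * (4 * η ^ 2 * (2 * Real.pi / L) ^ 2) * Real.sin (θL L (X i)) ^ 2)) *
        ∏ j ∈ Finset.univ.erase i, ‖orbη η L (X j)‖ ^ 2) ?_ L
    exact (hgc.comp (continuous_apply i)).mul
      (continuous_finsetProd _ fun j _ => ((continuous_orbη η L).norm.pow 2).comp (continuous_apply j))

/-- **Virial wave of the free gas** `I_k = 0` (its integrand carries the interaction). [folklore] -/
theorem virialWave_zero_potential (n : Fin 3 → ℤ) (Φ : PeriodicTrialState N L) : virialWave 0 n Φ = 0 :=
  virialWave_eq_zero_of_ae measurable_const (Filter.Eventually.of_forall fun _ => rfl) n Φ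

/-- **Stress wave of the free `η`-state** `P_k(Φ_η) = (|k|²/4)·m(Φ_η)`. [folklore] -/
theorem stressWave_zero_e0_prodStateη (η : ℝ) (N : ℕ) (hL : 0 < L) :
    stressWave 0 (Pi.single 0 1) (prodStateη η N hL) =
      (2 * Real.pi / L) ^ 2 / 4 * (N * (4 * η / (1 + 2 * η ^ 2))) := by
  unfold stressWave
  rw [kineticStressWave_e0_prodStateη, virialWave_zero_potential, sourceMean_e0_prodStateη, ksq_e0]
  ring

/-- The free energy of the `η`-state as a real number. [folklore] -/
theorem toReal_periodicEnergy_zero_prodStateη (η : ℝ) (N : ℕ) (hL : 0 < L) :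
    (periodicEnergy 0 (prodStateη η N hL)).toReal = N * (2 * η ^ 2 * (2 * Real.pi / L) ^ 2 / (1 + 2 * η ^ 2)) := by
  rw [periodicEnergy_zero_prodStateη, ENNReal.toReal_ofReal (by positivity)]

/-! ## The constitutive core is false for the free truncation -/

/-- **THE CONSTITUTIVE CORE IS FALSE FOR THE FREE GAS AT POSITIVE STIFFNESS PARAMETER** `a > 0`: the `η = 1`
free product state (`m = 4N/3`, `N_eff = 2N/3`, `K = I = 0`, `T = 2|k|²N/3`) in the mode `e₀` of the box `L = N/β`, driven at
`s = |k|²/2`, is transport-stationary, exactly sub-ground and positively modulated; window and `s ≤ ρa` hold for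
`β ≥ 4π²/M², 2π²/a`, diluteness for `N ≥ β³/ρ₀`, and the conclusion reads `2κaβ ≤ 3π²C₁`, false for
`β ≥ 3π²|C₁|/(2κa) + 1`. [folklore] -/
theorem coreIneq_zero_potential_false {a M ρ₀ κ : ℝ} (C₁ : ℝ) (N₀ : ℕ)
    (ha : 0 < a) (hM : 0 < M) (hρ₀ : 0 < ρ₀) (hκ : 0 < κ) : ¬ CoreIneq 0 a M ρ₀ κ C₁ N₀ := by
  intro h
  have hπ := Real.pi_pos
  obtain ⟨β, hβa, hβM, hβC, hβ1⟩ : ∃ β : ℝ, 2 * Real.pi ^ 2 / a ≤ β ∧ 4 * Real.pi ^ 2 / M ^ 2 ≤ β ∧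
      3 * Real.pi ^ 2 * |C₁| / (2 * κ * a) + 1 ≤ β ∧ 1 ≤ β := by
    refine ⟨max (max (2 * Real.pi ^ 2 / a) (4 * Real.pi ^ 2 / M ^ 2))
        (max (3 * Real.pi ^ 2 * |C₁| / (2 * κ * a) + 1) 1), ?_, ?_, ?_, ?_⟩
    · exact (le_max_left _ _).trans (le_max_left _ _)
    · exact (le_max_right _ _).trans (le_max_left _ _)
    · exact (le_max_left _ _).trans (le_max_right _ _)
    · exact (le_max_right _ _).trans (le_max_right _ _)
  have hβ : 0 < β := by linarith
  obtain ⟨N, hN0, hN1, hNbig⟩ : ∃ N : ℕ, N₀ ≤ N ∧ 1 ≤ N ∧ β ^ 3 / ρ₀ ≤ N := by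
    obtain ⟨m, hm⟩ := exists_nat_ge (β ^ 3 / ρ₀)
    exact ⟨max (max N₀ 1) m, (le_max_left _ _).trans (le_max_left _ _),
      (le_max_right _ _).trans (le_max_left _ _), hm.trans (by exact_mod_cast le_max_right _ _)⟩
  have hN1r : (1 : ℝ) ≤ N := by exact_mod_cast hN1
  have hNp : (0 : ℝ) < N := by linarith
  obtain ⟨L, hL_def⟩ : ∃ L : ℝ, L = N / β := ⟨_, rfl⟩
  have hL : 0 < L := by rw [hL_def]; positivity
  have hL0 : L ≠ 0 := hL.ne'
  have hNL : (N : ℝ) = β * L := by rw [hL_def]; field_simp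
  have hdil : (N : ℝ) ≤ ρ₀ * L ^ 3 := by
    have h1 : β ^ 3 ≤ ρ₀ * N := by rw [div_le_iff₀ hρ₀] at hNbig; linarith
    refine le_of_mul_le_mul_right ?_ (pow_pos hβ 3)
    calc (N : ℝ) * β ^ 3 ≤ N * (ρ₀ * N) := mul_le_mul_of_nonneg_left h1 hNp.le
      _ ≤ N * (ρ₀ * N) * N := le_mul_of_one_le_right (by positivity) hN1r
      _ = ρ₀ * L ^ 3 * β ^ 3 := by rw [hNL]; ring
  have hwin : 2 * Real.pi * ‖(fun j => ((Pi.single 0 1 : Fin 3 → ℤ) j : ℝ))‖ / L ≤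
      M * Real.sqrt (N / L ^ 3) := by
    rw [norm_e0, mul_one]
    have h4 : 4 * Real.pi ^ 2 ≤ β * M ^ 2 := (div_le_iff₀ (by positivity)).1 hβM
    have hsq : (2 * Real.pi / L) ^ 2 ≤ M ^ 2 * (N / L ^ 3) := by
      have e1 : (2 * Real.pi / L) ^ 2 = 4 * Real.pi ^ 2 / L ^ 2 := by field_simp; ring
      have e2 : M ^ 2 * (N / L ^ 3) = β * M ^ 2 / L ^ 2 := by rw [hNL]; field_simp
      rw [e1, e2]
      gcongr
    calc 2 * Real.pi / L = Real.sqrt ((2 * Real.pi / L) ^ 2) := (Real.sqrt_sq (by positivity)).symm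
      _ ≤ Real.sqrt (M ^ 2 * (N / L ^ 3)) := Real.sqrt_le_sqrt hsq
      _ = M * Real.sqrt (N / L ^ 3) := by rw [Real.sqrt_mul (sq_nonneg M), Real.sqrt_sq hM.le]
  obtain ⟨q, hq_def⟩ : ∃ q : ℝ, q = (2 * Real.pi / L) ^ 2 := ⟨_, rfl⟩
  obtain ⟨s, hs_def⟩ : ∃ s : ℝ, s = q / 2 := ⟨_, rfl⟩
  have hs0 : 0 ≤ s := by rw [hs_def, hq_def]; positivity
  have hs1 : s ≤ N / L ^ 3 * a := by
    have h2 : 2 * Real.pi ^ 2 ≤ β * a := (div_le_iff₀ ha).1 hβa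
    have e1 : s = 2 * Real.pi ^ 2 / L ^ 2 := by rw [hs_def, hq_def]; field_simp
    have e2 : (N : ℝ) / L ^ 3 * a = β * a / L ^ 2 := by rw [hNL]; field_simp
    rw [e1, e2]
    gcongr
  have hm_val : sourceMean (Pi.single 0 1) (prodStateη 1 N hL) = N * (4 / 3) := by
    rw [sourceMean_e0_prodStateη]; norm_num
  have hNeff_val : effNumber (Pi.single 0 1) (prodStateη 1 N hL) = N * (2 / 3) := by
    rw [effNumber_e0_prodStateη]; norm_num
  have hP_val : stressWave 0 (Pi.single 0 1) (prodStateη 1 N hL) = q / 4 * (N * (4 / 3)) := by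
    rw [stressWave_zero_e0_prodStateη, ← hq_def]; norm_num
  have hE_val : (periodicEnergy 0 (prodStateη 1 N hL)).toReal = N * (2 * q / 3) := by
    rw [toReal_periodicEnergy_zero_prodStateη, ← hq_def]; ring
  have hE : periodicEnergy 0 (prodStateη 1 N hL) ≠ ⊤ := by
    rw [periodicEnergy_zero_prodStateη]; exact ENNReal.ofReal_ne_top
  have hstat : stressWave 0 (Pi.single 0 1) (prodStateη 1 N hL) =
      s * effNumber (Pi.single 0 1) (prodStateη 1 N hL) := by
    rw [hP_val, hNeff_val, hs_def]; ring
  have hsub : (periodicEnergy 0 (prodStateη 1 N hL)).toReal - s * sourceMean (Pi.single 0 1) (prodStateη 1 N hL) ≤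
      (periodicGroundStateEnergy 0 N L).toReal := by
    rw [hE_val, hm_val, hs_def, periodicGroundStateEnergy_zero N hL, ENNReal.toReal_zero]
    have : (N : ℝ) * (2 * q / 3) - q / 2 * (N * (4 / 3)) = 0 := by ring
    rw [this]
  have hm0 : 0 ≤ sourceMean (Pi.single 0 1) (prodStateη 1 N hL) := by rw [hm_val]; positivity
  have key := h N hN0 L hL hdil (Pi.single 0 1) e0_ne_zero hwin s hs0 hs1 (prodStateη 1 N hL) hE hstat hsub hm0
  rw [kineticStressWave_e0_prodStateη, virialWave_zero_potential, hm_val, zero_add, zero_add, hs_def,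
    hq_def] at key
  have key2 : 2 * κ * a * β ≤ 3 * Real.pi ^ 2 * C₁ := by
    have e1 : κ * (N / L ^ 3 * a) * (N * (4 / 3)) = (2 * κ * a * β) * (2 * N / (3 * L ^ 2)) := by
      rw [hNL]; field_simp; ring
    have e2 : C₁ * ((2 * Real.pi / L) ^ 2 / 2) * N = (3 * Real.pi ^ 2 * C₁) * (2 * N / (3 * L ^ 2)) := by
      field_simp
    rw [e1, e2] at key
    exact le_of_mul_le_mul_right key (by positivity)
  have hC : 3 * Real.pi ^ 2 * |C₁| ≤ (β - 1) * (2 * κ * a) :=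
    (div_le_iff₀ (by positivity : (0 : ℝ) < 2 * κ * a)).1 (by linarith)
  have hC1 : 3 * Real.pi ^ 2 * C₁ ≤ 3 * Real.pi ^ 2 * |C₁| :=
    mul_le_mul_of_nonneg_left (le_abs_self C₁) (by positivity)
  have hκa : 0 < 2 * κ * a := by positivity
  nlinarith

/-- **… and TRUE at `a = 0`**: the window pins `s = 0`, sub-ground pins `T(Φ) ≤ E₀(0) = 0`, so `K_k = 0`
(`|K_k| ≤ 2T`) and the conclusion is `0 ≤ 0`. [folklore] -/
theorem coreIneq_zero_zero (M ρ₀ κ C₁ : ℝ) (N₀ : ℕ) : CoreIneq 0 0 M ρ₀ κ C₁ N₀ := by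
  intro N _ L hL _ n _ _ s hs0 hs1 Φ _ _ hsub _
  have hs : s = 0 := le_antisymm (by simpa using hs1) hs0
  subst hs
  rw [virialWave_zero_potential]
  simp only [mul_zero, zero_mul, add_zero, sub_zero] at hsub ⊢
  rw [periodicGroundStateEnergy_zero N hL, ENNReal.toReal_zero,
    periodicEnergy_eq_ofReal_of_ae (w := 0) measurable_const (Filter.Eventually.of_forall fun _ => rfl) Φ,
    ENNReal.toReal_ofReal (cellKineticEnergy_nonneg L Φ.ψ)] at hsub
  have hK : -(2 * cellKineticEnergy L Φ.ψ) ≤ kineticStressWave n Φ :=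
    (neg_le_neg (abs_kineticStressWave_le n Φ)).trans (neg_abs_le _)
  linarith

/-- **S2 WITHOUT THE TRUNCATION THRESHOLD IS FALSE** (mutation `∃ t₀ ∀ t ≥ t₀ ↦ ∀ t` of `ConstitutiveCore`):
`truncPotential v 0 = 0` is the free gas while the stiffness is the envelope's `a(v) > 0` — square well `8·𝟙_{r ≤ 1}`,
`a ≥ 1/2`.  Contrast: S3b `KineticSignCoherenceUnbounded` holds with `t₀ = 0`. [folklore] -/
theorem constitutiveCore_false_without_threshold :
    ¬ (∀ v : ℝ → ℝ≥0∞, IsRepulsiveFiniteRange v → ∀ M : ℝ, 0 < M →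
        ∃ ρ₀ κ C₁ : ℝ, 0 < ρ₀ ∧ 0 < κ ∧ 0 < C₁ ∧ ∃ N₀ : ℕ, ∀ t : ℕ,
          CoreIneq (truncPotential v t) (scatteringLength v).toReal M ρ₀ κ C₁ N₀) := by
  intro h
  obtain ⟨ρ₀, κ, C₁, hρ₀, hκ, -, N₀, hcore⟩ := h (sqWell 8 1) (isRepulsiveFiniteRange_sqWell 8 1) 1 one_pos
  have htr : truncPotential (sqWell 8 1) 0 = 0 := by
    funext r; simp [truncPotential]
  have h0 := hcore 0
  rw [htr] at h0
  have ha : 0 < (scatteringLength (sqWell 8 1)).toReal := by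
    linarith [scatteringLength_sqWell_eight_one.1]
  exact coreIneq_zero_potential_false C₁ N₀ ha one_pos hρ₀ hκ h0

/-- `t = 0` is never an admissible truncation height in S2 when `a(v) > 0` (unlike in S3b). [folklore] -/
theorem not_coreIneq_trunc_zero {v : ℝ → ℝ≥0∞} (hv : 0 < (scatteringLength v).toReal)
    {M ρ₀ κ : ℝ} (C₁ : ℝ) (N₀ : ℕ) (hM : 0 < M) (hρ₀ : 0 < ρ₀) (hκ : 0 < κ) :
    ¬ CoreIneq (truncPotential v 0) (scatteringLength v).toReal M ρ₀ κ C₁ N₀ := by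
  have htr : truncPotential v 0 = 0 := by
    funext r; simp [truncPotential]
  rw [htr]
  exact coreIneq_zero_potential_false C₁ N₀ hv hM hρ₀ hκ

end

end Summit.AtomisticToContinuum.BoseEinsteinCondensation.Theorems.DensityResponse.Negative.ForceBalanceStubs
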